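import Mathlib
import Summits.Ventures.PercRepro2.Defs
import Summits.Ventures.PercRepro2.Graph
import Summits.Ventures.PercRepro2.OneColourSwitch
import Summits.Ventures.PercRepro2.RegionHubSign
import Summits.Ventures.PercRepro2.SideSwitch
import Summits.Ventures.PercRepro2.SideSwitchFibre
import Summits.Ventures.PercRepro2.SideSwitchClosed
import Summits.Ventures.PercRepro2.SideSwitchComps
import Summits.Ventures.PercRepro2.TermSwitchDefs
import Summits.Ventures.PercRepro2.TermSwitchFibre
import Summits.Ventures.PercRepro2.TermSwitchMono
import Summits.Ventures.PercRepro2.TermSwitchM9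
import Summits.Ventures.PercRepro2.TermSwitchRestrict
import Summits.Ventures.PercRepro2.M9NoPocketDefs
import Summits.Ventures.PercRepro2.M9NoPocketFibre
import Summits.Ventures.PercRepro2.M9NoPocketCompl
import Summits.Ventures.PercRepro2.M9PocketCubeDefs
import Summits.Ventures.PercRepro2.M9PocketCubeFibre
import Summits.Ventures.PercRepro2.M9Unreached
import Summits.Ventures.PercRepro2.M9PocketRepWorld

/-!
# The pocket representative is invariant under the `{r, s}`-switches of `G` (blind cell
PercRepro2, p3 g25, 2026-08-28; `proofs/P3-GENERALD.md` §6′) — part B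

With the worlds of `G − d` under `assignC T ρ` from part A (`M9PocketRepWorld`): the `W`-side of
`G − d` of `assignC T ρ` is `inWorld T ρ` (`Bside_endsD_assignC`), its unexplored part is that of
`ρ` (`Oprime_assignC`), and the normalisation of the free edges (`normP`: `T`-edges `Y`, pocket
edges `W`) of `assignC T ρ` is the block switch of `inWorld` applied to the normalisation of `ρ`
(`normP_assignC`).  Hence the pocket representative `repP d r s` of `M9PocketCubeDefs` is
unchanged by the component assignments of the `{r, s}`-fibration of `G`
(`repP_assignC_of_repH`) and by its outside flip, which flips pocket edges only
(`repP_flipOH_of_repH`).  Consequently the restricted terminal-set theorem applies to the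
predicate «`d` reached and `repP ω = ρ₀`» (`dzeroSignSumHP_repP_nonpos`): the reached
`Sep ∧ DZero` colourings with a GIVEN pocket representative — the one-sided points `A ∪ B` of
that pocket representative — have non-positive sum.  Own work; std axioms.
-/

namespace Summit.Ventures.PercRepro2

namespace NoPocket

open Finset Classical RegionHub OneColourSwitch SideSwitch TermSwitch

variable {V : Type*} {E : Type*}

section Switch

variable [Fintype V] [DecidableEq V] [Fintype E] [DecidableEq E] {ends : E → Sym2 V}
  {p q r s d : V}
/-- The `W`-side of `G − d` of `assignC T ρ` is `inWorld`. -/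
lemma Bside_endsD_assignC (hr : d ≠ r) (hs : d ≠ s) {ρ : Config E}
    (hG : ρ ∈ RepH ends p q ({r, s} : Set V)) {T : Finset (Finset V)}
    (hT : T ⊆ compsH ends ({r, s} : Set V) ρ) :
    Bside (endsD ends d) r s (assignC ends T ρ) = inWorld ends d r s T ρ := by
  ext x
  rw [mem_Bside, M2_endsD_assignC hr hs hG hT]
  constructor
  · rintro ⟨hx, hxr, hxs⟩
    rcases hx with hM | hI
    · exfalso
      rcases eq_r_or_s_of_mem_M2_endsD_of_repH (d := d) hG hM with h | h
      · exact hxr h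
      · exact hxs h
    · exact Finset.mem_coe.1 hI
  · intro hx
    exact ⟨Or.inr (Finset.mem_coe.2 hx), (ne_rsd_of_mem_inWorld hr hs hx).1,
      (ne_rsd_of_mem_inWorld hr hs hx).2.1⟩

/-- The unexplored part of `G − d` is unchanged by `assignC T ρ`. -/
lemma Oprime_assignC (hr : d ≠ r) (hs : d ≠ s) {ρ : Config E}
    (hG : ρ ∈ RepH ends p q ({r, s} : Set V)) {T : Finset (Finset V)}
    (hT : T ⊆ compsH ends ({r, s} : Set V) ρ) :
    Oprime ends d r s (assignC ends T ρ) = Oprime ends d r s ρ := by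
  ext y
  rw [mem_Oprime, mem_Oprime, K2_endsD_assignC hr hs hG hT, M2_endsD_assignC hr hs hG hT]
  constructor
  · rintro ⟨hK, hM⟩
    refine ⟨fun h => hK ⟨h, fun hI => hM (Or.inr hI)⟩, fun h => hM (Or.inl h)⟩
  · rintro ⟨hK, hM⟩
    refine ⟨fun h => hK h.1, ?_⟩
    rintro (h | h)
    · exact hM h
    · exact hK (inWorld_subset_K2_endsD hG (Finset.mem_coe.1 h))


omit [Fintype V] in
/-- The normalisation, edgewise: `T`-edges `Y`, pocket edges `W`, the rest unchanged. -/
lemma normP_apply (ω : Config E) (e : E) :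
    normP ends d r s ω e =
      if e ∈ Tset ends d r s then true else if e ∈ Pk ends d r s ω then false else ω e := by
  unfold normP
  by_cases hT : e ∈ Tset ends d r s
  · rw [if_pos hT]
    have hnP : e ∉ Pk ends d r s ω := Tset_not_mem_Pk ω hT
    cases he : ω e
    · have hm : e ∈ wT ends d r s ω ∪ yPk ends d r s ω :=
        Finset.mem_union_left _ (Finset.mem_filter.2 ⟨hT, he⟩)
      rw [flipF_of_mem hm, he]
      rfl
    · have hm : e ∉ wT ends d r s ω ∪ yPk ends d r s ω := by
        intro h
        rcases Finset.mem_union.1 h with h | h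
        · have h2 := (Finset.mem_filter.1 h).2
          rw [he] at h2
          simp at h2
        · exact hnP (Finset.mem_filter.1 h).1
      rw [flipF_of_notMem hm, he]
  · rw [if_neg hT]
    by_cases hP : e ∈ Pk ends d r s ω
    · rw [if_pos hP]
      cases he : ω e
      · have hm : e ∉ wT ends d r s ω ∪ yPk ends d r s ω := by
          intro h
          rcases Finset.mem_union.1 h with h | h
          · exact hT (Finset.mem_filter.1 h).1
          · have h2 := (Finset.mem_filter.1 h).2
            rw [he] at h2
            exact Bool.false_ne_true h2
        rw [flipF_of_notMem hm, he]
      · have hm : e ∈ wT ends d r s ω ∪ yPk ends d r s ω :=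
          Finset.mem_union_right _ (Finset.mem_filter.2 ⟨hP, he⟩)
        rw [flipF_of_mem hm, he]
        rfl
    · rw [if_neg hP]
      have hm : e ∉ wT ends d r s ω ∪ yPk ends d r s ω := by
        intro h
        rcases Finset.mem_union.1 h with h | h
        · exact hT (Finset.mem_filter.1 h).1
        · exact hP (Finset.mem_filter.1 h).1
      exact flipF_of_notMem hm

/-- The pocket edges of `assignC T ρ` are those of `ρ`. -/
lemma Pk_assignC (hr : d ≠ r) (hs : d ≠ s) {ρ : Config E}
    (hG : ρ ∈ RepH ends p q ({r, s} : Set V)) {T : Finset (Finset V)}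
    (hT : T ⊆ compsH ends ({r, s} : Set V) ρ) :
    Pk ends d r s (assignC ends T ρ) = Pk ends d r s ρ := by
  unfold Pk
  rw [Oprime_assignC hr hs hG hT]

omit [Fintype E] [DecidableEq E] in
/-- A vertex outside the unexplored part of `G − d` is `r`, `s` or a sided vertex of `G − d`. -/
lemma rs_or_A0_of_not_mem_Oprime {ρ : Config E} {x : V} (hx : x ∉ Oprime ends d r s ρ) :
    x = r ∨ x = s ∨ x ∈ A0 (endsD ends d) r s ρ := by
  by_cases hxr : x = r
  · exact Or.inl hxr
  by_cases hxs : x = s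
  · exact Or.inr (Or.inl hxs)
  refine Or.inr (Or.inr (mem_A0.2 ⟨?_, hxr, hxs⟩))
  rw [mem_Oprime, not_and_or, not_not, not_not] at hx
  exact hx

/-- **The normalisation of `assignC T ρ` is the block switch of `inWorld` applied to the
normalisation of `ρ`.** -/
lemma normP_assignC (hr : d ≠ r) (hs : d ≠ s) {ρ : Config E}
    (hG : ρ ∈ RepH ends p q ({r, s} : Set V)) {T : Finset (Finset V)}
    (hT : T ⊆ compsH ends ({r, s} : Set V) ρ) :
    normP ends d r s (assignC ends T ρ) =
      flipTouch ends (↑(inWorld ends d r s T ρ) : Set V) (normP ends d r s ρ) := by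
  funext e
  rw [normP_apply, Pk_assignC hr hs hG hT]
  by_cases hTe : e ∈ Tset ends d r s
  · -- a `T`-edge does not touch `inWorld`
    have hnt : e ∉ touches ends (↑(inWorld ends d r s T ρ) : Set V) := by
      rintro ⟨x, hx, y, hends⟩
      have hx' := ne_rsd_of_mem_inWorld hr hs (Finset.mem_coe.1 hx)
      rcases mem_Tset.1 hTe with h | h
      · rw [h, Sym2.eq_iff] at hends
        rcases hends with ⟨h1, _⟩ | ⟨_, h2⟩
        · exact hx'.2.2 h1.symm
        · exact hx'.1 h2.symm
      · rw [h, Sym2.eq_iff] at hends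
        rcases hends with ⟨h1, _⟩ | ⟨_, h2⟩
        · exact hx'.2.2 h1.symm
        · exact hx'.2.1 h2.symm
    rw [if_pos hTe, flipTouch_of_notMem ends hnt, normP_apply, if_pos hTe]
  · rw [if_neg hTe]
    by_cases hPe : e ∈ Pk ends d r s ρ
    · -- a pocket edge does not touch `inWorld` (its endpoints are unexplored)
      have hnt : e ∉ touches ends (↑(inWorld ends d r s T ρ) : Set V) := by
        rintro ⟨x, hx, y, hends⟩
        obtain ⟨u, hu, v, hv, huv⟩ := mem_Pk.1 hPe
        have hxA := (mem_inWorld.1 (Finset.mem_coe.1 hx)).2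
        rw [hends, Sym2.eq_iff] at huv
        have hxO : x ∈ Oprime ends d r s ρ := by
          rcases huv with ⟨h1, _⟩ | ⟨h2, _⟩
          · rw [h1]; exact hu
          · rw [h2]; exact hv
        rw [mem_Oprime] at hxO
        rw [mem_A0] at hxA
        rcases hxA.1 with h | h
        · exact hxO.1 h
        · exact hxO.2 h
      rw [if_pos hPe, flipTouch_of_notMem ends hnt, normP_apply, if_neg hTe, if_pos hPe]
    · rw [if_neg hPe, assignC_eq]
      have hn : normP ends d r s ρ e = ρ e := by
        rw [normP_apply, if_neg hTe, if_neg hPe]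
      -- `e` touches `unionT T` iff it touches `inWorld`
      have key : e ∈ touches ends (↑(unionT T) : Set V) ↔
          e ∈ touches ends (↑(inWorld ends d r s T ρ) : Set V) := by
        -- some endpoint of `e` is explored in `G − d`
        by_cases hd : d ∈ ends e
        · -- an edge at `d`: `d–y` with `y` explored (not `r`, `s`, not unexplored)
          obtain ⟨y, hy⟩ := Sym2.mem_iff_exists.1 hd
          have hyrs : y ≠ r ∧ y ≠ s := by
            constructor
            · rintro rfl
              exact hTe (mem_Tset.2 (Or.inl hy))
            · rintro rfl
              exact hTe (mem_Tset.2 (Or.inr hy))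
          have hyO : y ∉ Oprime ends d r s ρ := by
            intro hyO
            apply hPe
            rw [mem_Pk]
            refine ⟨d, ?_, y, hyO, hy⟩
            rw [mem_Oprime]
            exact ⟨not_mem_K2_endsD hr hs ρ, not_mem_M2_endsD hr hs ρ⟩
          have hyA : y ∈ A0 (endsD ends d) r s ρ := by
            rcases rs_or_A0_of_not_mem_Oprime hyO with h | h | h
            · exact (hyrs.1 h).elim
            · exact (hyrs.2 h).elim
            · exact h
          constructor
          · rintro ⟨u, hu, v, huv⟩
            have hu' : u ∈ unionT T := Finset.mem_coe.1 hu
            rw [hy, Sym2.eq_iff] at huv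
            have hyU : y ∈ unionT T := by
              rcases huv with ⟨hud, _⟩ | ⟨_, hyu⟩
              · -- `u = d ∈ unionT T`: `y` is a sided vertex of `G` adjacent to `d`
                rw [← hud] at hu'
                exact mem_unionT_of_edge hT hy hu' (mem_A0H_of_mem_A0_endsD hyA)
              · rw [hyu]; exact hu'
            exact mem_touches_of_ends hy (Or.inr (Finset.mem_coe.2 (mem_inWorld.2 ⟨hyU, hyA⟩)))
          · rintro ⟨u, hu, v, huv⟩
            exact ⟨u, Finset.mem_coe.2 (mem_inWorld.1 (Finset.mem_coe.1 hu)).1, v, huv⟩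
        · -- an edge not at `d`, not a pocket edge: an endpoint is explored
          obtain ⟨x, y, hends⟩ : ∃ x y, ends e = s(x, y) :=
            Sym2.inductionOn (ends e) (fun x y => ⟨x, y, rfl⟩)
          by_cases hxO : x ∈ Oprime ends d r s ρ
          · have hyO : y ∉ Oprime ends d r s ρ := by
              intro hyO
              exact hPe (mem_Pk.2 ⟨x, hxO, y, hyO, hends⟩)
            exact touches_iff_of_touches_world hr hs hT hd (by rw [hends, Sym2.eq_swap])
              (rs_or_A0_of_not_mem_Oprime hyO)
          · exact touches_iff_of_touches_world hr hs hT hd hends (rs_or_A0_of_not_mem_Oprime hxO)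
      by_cases h : e ∈ touches ends (↑(unionT T) : Set V)
      · rw [flipTouch_of_mem ends h, flipTouch_of_mem ends (key.1 h), hn]
      · rw [flipTouch_of_notMem ends h, flipTouch_of_notMem ends (fun h' => h (key.2 h')), hn]

/-- **The pocket representative is invariant under the component assignments of the
`{r, s}`-fibration of `G`.** -/
theorem repP_assignC_of_repH (hr : d ≠ r) (hs : d ≠ s) {ρ : Config E}
    (hG : ρ ∈ RepH ends p q ({r, s} : Set V)) {T : Finset (Finset V)}
    (hT : T ⊆ compsH ends ({r, s} : Set V) ρ) :
    repP (ends := ends) d r s (assignC ends T ρ) = repP (ends := ends) d r s ρ := by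
  rw [repP_eq, Bside_endsD_assignC hr hs hG hT]
  change flipTouch ends (↑(inWorld ends d r s T ρ) : Set V) (normP ends d r s (assignC ends T ρ)) =
    repP (ends := ends) d r s ρ
  rw [normP_assignC hr hs hG hT, flipTouch_flipTouch, repP_eq_normP_of_repH hG]

omit [Fintype V] [DecidableEq V] in
/-- The outside flip of the `{r, s}`-fibration flips pocket edges only. -/
lemma flipOH_eq_flipF {ρ : Config E} :
    flipOH ends ({r, s} : Set V) ρ =
      flipF (univ.filter (fun e => e ∈ within ends (OsetH ends ({r, s} : Set V) ρ))) ρ := by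
  funext e
  simp only [flipOH]
  by_cases h : e ∈ within ends (OsetH ends ({r, s} : Set V) ρ)
  · rw [flipIn_of_mem h, flipF_of_mem (Finset.mem_filter.2 ⟨Finset.mem_univ _, h⟩)]
  · rw [flipIn_of_notMem h, flipF_of_notMem (fun h' => h (Finset.mem_filter.1 h').2)]

omit [Fintype V] [DecidableEq V] [DecidableEq E] in
/-- An edge inside the outside of `G` is a pocket edge of `G − d`. -/
lemma outside_edges_subset_Pk {ρ : Config E} :
    univ.filter (fun e => e ∈ within ends (OsetH ends ({r, s} : Set V) ρ)) ⊆ Pk ends d r s ρ := by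
  intro e he
  obtain ⟨x, hx, y, hy, hends⟩ := (Finset.mem_filter.1 he).2
  have hO : ∀ z ∈ OsetH ends ({r, s} : Set V) ρ, z ∈ Oprime ends d r s ρ := by
    intro z hz
    rw [mem_Oprime]
    have hz' : z ∉ K2 ends r s ρ ∪ M2 ends r s ρ := hz
    exact ⟨fun h => hz' (Or.inl (K2_endsD_subset ρ h)),
      fun h => hz' (Or.inr (M2_endsD_subset ρ h))⟩
  exact mem_Pk.2 ⟨x, hO x hx, y, hO y hy, hends⟩

/-- **The pocket representative is invariant under the outside flip of the `{r, s}`-fibration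
of `G`.** -/
theorem repP_flipOH_of_repH (hr : d ≠ r) (hs : d ≠ s) {ρ : Config E}
    (hG : ρ ∈ RepH ends p q ({r, s} : Set V)) :
    repP (ends := ends) d r s (flipOH ends ({r, s} : Set V) ρ) = repP (ends := ends) d r s ρ := by
  have hF : univ.filter (fun e => e ∈ within ends (OsetH ends ({r, s} : Set V) ρ)) ⊆
      freeE ends d r s ρ := fun e he => mem_freeE.2 (Or.inr (outside_edges_subset_Pk he))
  rw [flipOH_eq_flipF]
  set F := univ.filter (fun e => e ∈ within ends (OsetH ends ({r, s} : Set V) ρ)) with hFdef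
  have hK : K2 (endsD ends d) r s (flipF F ρ) = K2 (endsD ends d) r s ρ :=
    K2_endsD_flipF_free hr hs hF
  have hM : M2 (endsD ends d) r s (flipF F ρ) = M2 (endsD ends d) r s ρ :=
    M2_endsD_flipF_free hr hs hF
  have hB : Bside (endsD ends d) r s (flipF F ρ) = ∅ := by
    refine Finset.eq_empty_of_forall_notMem fun y hy => ?_
    obtain ⟨hyM, hyr, hys⟩ := mem_Bside.1 hy
    rw [hM] at hyM
    rcases eq_r_or_s_of_mem_M2_endsD_of_repH (d := d) hG hyM with h | h
    · exact hyr h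
    · exact hys h
  have hP : Pk ends d r s (flipF F ρ) = Pk ends d r s ρ := by
    unfold Pk
    have : Oprime ends d r s (flipF F ρ) = Oprime ends d r s ρ := by
      ext y
      rw [mem_Oprime, mem_Oprime, hK, hM]
    rw [this]
  rw [repP_eq, hB, flipTouch_empty, repP_eq_normP_of_repH hG]
  change normP ends d r s (flipF F ρ) = normP ends d r s ρ
  funext e
  rw [normP_apply, normP_apply, hP]
  by_cases hTe : e ∈ Tset ends d r s
  · rw [if_pos hTe, if_pos hTe]
  · rw [if_neg hTe, if_neg hTe]
    by_cases hPe : e ∈ Pk ends d r s ρ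
    · rw [if_pos hPe, if_pos hPe]
    · rw [if_neg hPe, if_neg hPe]
      exact flipF_of_notMem (fun h => hPe (outside_edges_subset_Pk h))

end Switch

section Main

variable [Fintype V] [DecidableEq V] [Fintype E] [DecidableEq E] {ends : E → Sym2 V}
  {p q r s d : V}

/-- **The reached `Sep ∧ DZero` colourings with a given pocket representative have non-positive
sum**: the restricted `{r, s}`-terminal theorem with the fibre-invariant predicate
«`d ∉ O_H` and `repP ω = ρ₀`». -/
theorem dzeroSignSumHP_repP_nonpos (hr : d ≠ r) (hs : d ≠ s) (ρ₀ : Config E) :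
    dzeroSignSumHP ends p q r s ({r, s} : Set V)
      (fun ω => d ∉ OsetH ends ({r, s} : Set V) ω ∧ repP (ends := ends) d r s ω = ρ₀) ≤ 0 := by
  refine dzeroSignSumHP_nonpos p q s (by simp) _ ?_ ?_
  · intro ρ hρ T hT
    rw [OsetH_assignC hT, repP_assignC_of_repH hr hs hρ hT]
  · intro ρ hρ
    rw [repP_flipOH_of_repH hr hs hρ]
    simp only [flipOH]
    rw [OsetH_flipIn]

end Main

end NoPocket

end Summit.Ventures.PercRepro2
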